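import Literature.MathematicalPhysics.QuantumFieldTheory.Balaban1983to89.B5Strip145Analytic

/-!
# NE7K1LinBlochDenominator — row NE7 (node U5), candidate route HOM, path H1L, cell K1-lin(s): NEEDS-ESTIMATE #E1, B-E1 TYPED —
# THE BLOCH ∕ ALIAS DENOMINATOR `𝓝_L` OF THE BLOCK-MEAN MULTIPLIER `k_L = Δ^ξ_L ∕ 𝓝_L` IS THE `a`-SLOPE OF b04's REGROUPED
# DENOMINATOR `B4Strip.E` AT `(n, m²) = (L, 0)`, AND IT HAS NO ZERO ON A COMPLEX STRIP WHOSE HALF-WIDTH DEPENDS ON `d` ALONE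
# (THEOREM S of lens 2's S-64-1, priced by the desk PRICING-NE7 v32 §233 (f): «B-E1 := TYPING ONLY (XS–S)»)

Lineage `b2b-balaban-t4-ne7-p2` (CRUX PROVER NE7 #2), generation 74; file 47.  Files 36–46 typed B-E1's clauses for the FINITE-TORUS
symbol `σ_s(p)` of the doubled-torus two-cutoff line.  Lens 2 (t4-ne7-idea-2 g64, `t4/ideate/NE7/lens2-g64/BE1-SUPPLY.md` = S-64-1,
and N-67-1 of g67) located the CONTINUUM multiplier the strip engine (R-E1) actually contour-shifts: the block-mean Schur-complement
multiplier `k_L(p) = 1 ∕ A_L(p)`, `A_L(p) = Σ_{k ∈ (ℤ∕L)^D} |u(p+2πk)|² ∕ Δ^ξ(p+2πk)` (B4 (2.47)–(2.48) one level down), whose samples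
at the dual momenta of a torus are the finite-torus symbol, and observed that its regrouped denominator
`𝓝_L := Δ^ξ_L · A_L = U_L(0;·) + Σ_{k ≠ 0} U_L(k;·)·Δ^ξ_L ∕ Δ^ξ_L(· + 2πk)` is EXACTLY the `a`-slope of the tree's regrouped
denominator `B4Strip.E L a 0` — so b04's own zero-free-strip architecture (`B4Strip.strip_lower_bound` fed by
`B4StripCauchy.imLipschitz_of_fat`) runs on `𝓝_L` verbatim, uniformly in `L ≥ 1`.  THIS FILE TYPES THAT (the desk's list
«`Nsym` ∕ `E_one_zero_eq` ∕ `Nsym_real_ge` ∕ `norm_Nsym_le` ∕ `Nsym_strip_lower`»):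

* §1 `Nsym L p` (and its real form `Nsymr`); `E_eq_DeltaXi_add_mul_Nsym : E L a 0 p = Δ^ξ_L(p) + a·𝓝_L(p)` for EVERY `a`,
  `E_one_zero_eq`, `Nsym_eq_E_sub`; `Nsym_ofReal`.
* §2 REAL FLOOR `Nsymr_ge : (4∕π²)^d ≤ 𝓝_L(s)` on the Brillouin zone, all `L ≥ 1` (`B4Strip.Ur_zero_ge` + non-negativity of the
  alias terms — the lines `h2`, `h3` of the tree's `Er_ge`); `Nsym_real_ge` (modulus form).
* §3 FAT-REGION BOUND `norm_Nsym_le : ‖𝓝_L(q)‖ ≤ M_N(d) := 4^d + 8d·132^d` on `B4StripCauchy.Fat d r` (`r ≤ 1∕4`, `d r² ≤ 1∕16`),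
  UNIFORM IN `L` (`norm_U_zero_le`, `sum_norm_U_le`, `norm_DeltaXi_le`, `norm_DeltaXi_shift_ge` — the `a`-slope of `boundM`).
* §4 JOINT HOLOMORPHY `differentiableAt_Nsym` on the fat region (`B5Strip145Analytic.differentiableAt_E` minus `differentiableAt_DeltaXi`)
  and its slice form; the imaginary-direction Lipschitz bound `Nsym_imLipschitz` (`imLipschitz_of_fat`, constant `Λ_N(d) = M_N(d) ∕ r(d)`).
* §5 **THEOREM S** `Nsym_strip_lower`: with `c_N(d) := (4∕π²)^d ∕ 2`, `κ_N(d) := min (r(d), c_N(d) ∕ (Λ_N(d)·d + 1)) > 0`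
  (`r(d) = B4StripCauchy.rOf d = 1∕(4(d+1))`): for EVERY `L ≥ 1` and every `p ∈ B4Strip.Strip d κ_N(d)`, `c_N(d) ≤ ‖𝓝_L(p)‖`
  (`B4Strip.strip_lower_bound`, the shape of `B4StripCauchy.uniformStrip_explicit`); `Nsym_ne_zero`.
* §6 the OBJECT `kL L p := Δ^ξ_L(p) ∕ 𝓝_L(p)` (and `kLr`; `kL_ofReal` — real on real momenta, `kLr_nonneg`, `kL_zero`); its strip
  clauses (holomorphy, bound, the `2π` law, `B4ContourShift.StripRegular`) are file 48's.

HONEST FRAMING: [folklore] — b04's supplied strip lemma re-run on the `a`-slope of its own denominator; every estimate is the tree's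
(`B4Strip`, `B4StripCauchy`, `B5Strip145Analytic`) BY NAME; the constants are existence-grade (`κ_N(4) ≈ 1.7·10⁻¹⁴` against the true
pole height `1.1978` of record — the desk ruled the size irrelevant, PRICING-NE7 §216 (c)); the identification of the finite-torus
symbol of files 36–37 with the samples of `k_L` (per-fibre KKT) is NOT typed here; R-E1 (the class-S re-typing of the strip engine)
untouched; nothing of Bałaban's asserted; no `sorry`.  Census only (B-E1's zero-free strip for the CONTINUUM block-mean multiplier,
I3-free and torus-free); NE7 NOT PRINTED ∕ NOT PROVED; spine 0∕9; FIXED FINITE T⁴, rung (B)+1; NOT infinite volume, NOT mass gap,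
NOT Clay.  HONEST DEPENDENCY: continuum YM on T⁴ ⇐ BetaPertH ∧ nine spine estimates (0/9 proved); BetaPertH ⇐ (D1) ∧ (D4) ∧ CAP+tail;
G-an2-4 gates asym, D1 and NE2/3/4.
-/

noncomputable section

open Finset Complex

namespace Summit.QuantumFields.BalabanUV.T4Continuum.NE7K1LinBlochDenominator

open Literature.MathematicalPhysics.QuantumFieldTheory.Balaban1983to89
open Literature.MathematicalPhysics.QuantumFieldTheory.Balaban1983to89.B4Strip
open Literature.MathematicalPhysics.QuantumFieldTheory.Balaban1983to89.B4StripCauchy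
open Literature.MathematicalPhysics.QuantumFieldTheory.Balaban1983to89.B5Strip145Analytic

variable {d : ℕ}

/-! ### §1 The Bloch ∕ alias denominator `𝓝_L` and its relation to `B4Strip.E` -/

/-- THE BLOCH ∕ ALIAS DENOMINATOR of the block-mean multiplier one blocking level down:
`𝓝_L(p) = U_L(0; p) + Σ_{k ≠ 0} U_L(k; p) · Δ^ξ_L(p) ∕ Δ^ξ_L(p + 2πk)` (`ξ = 1∕L`, `m² = 0`) — the regrouped, pole-free form of
`Δ^ξ_L(p) · Σ_k |u(p+2πk)|² ∕ Δ^ξ_L(p+2πk)`; the block-mean multiplier is `k_L = Δ^ξ_L ∕ 𝓝_L` (file 48). [folklore] -/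
def Nsym (L : ℕ) [NeZero L] (p : Fin d → ℂ) : ℂ :=
  U L (fun _ => (0 : Fin L)) p
    + ∑ k ∈ (Finset.univ.erase (fun _ => (0 : Fin L))), U L k p * (DeltaXi L 0 p / DeltaXi L 0 (shift L k p))

/-- real form of `𝓝_L` (its values on real momenta). [folklore] -/
def Nsymr (L : ℕ) [NeZero L] (s : Fin d → ℝ) : ℝ :=
  Ur L (fun _ => (0 : Fin L)) s
    + ∑ k ∈ (Finset.univ.erase (fun _ => (0 : Fin L))), Ur L k s * (DeltaXir L 0 s / DeltaXir L 0 (shiftr L k s))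

/-- `𝓝_L` IS THE `a`-SLOPE OF b04's REGROUPED DENOMINATOR at `(n, m²) = (L, 0)`: `E_L(a, 0; p) = Δ^ξ_L(p) + a · 𝓝_L(p)` for every
coupling `a` (lens 2's S-64-1 §1, CLAIM located on `B4Strip.E`'s body). [folklore] -/
theorem E_eq_DeltaXi_add_mul_Nsym (L : ℕ) [NeZero L] (a : ℝ) (p : Fin d → ℂ) :
    E L a 0 p = DeltaXi L 0 p + (a : ℂ) * Nsym L p := by
  unfold E Nsym
  ring

/-- the desk's `E_one_zero_eq`: `E_L(1, 0; p) = Δ^ξ_L(p) + 𝓝_L(p)`. [folklore] -/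
theorem E_one_zero_eq (L : ℕ) [NeZero L] (p : Fin d → ℂ) : E L 1 0 p = DeltaXi L 0 p + Nsym L p := by
  rw [E_eq_DeltaXi_add_mul_Nsym]; push_cast; ring

/-- `𝓝_L = E_L(1,0;·) − Δ^ξ_L`. [folklore] -/
theorem Nsym_eq_E_sub (L : ℕ) [NeZero L] (p : Fin d → ℂ) : Nsym L p = E L 1 0 p - DeltaXi L 0 p := by
  rw [E_one_zero_eq]; ring

/-- as functions: `𝓝_L = E_L(1,0;·) − Δ^ξ_L`. [folklore] -/
theorem Nsym_eq_fun (L : ℕ) [NeZero L] : (Nsym L : (Fin d → ℂ) → ℂ) = fun p => E L 1 0 p - DeltaXi L 0 p :=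
  funext (Nsym_eq_E_sub L)

/-- on real momenta `𝓝_L` is the real number `Nsymr`. [folklore] -/
theorem Nsym_ofReal (L : ℕ) [NeZero L] (s : Fin d → ℝ) : Nsym L (ofRealVec s) = ((Nsymr L s : ℝ) : ℂ) := by
  unfold Nsym Nsymr
  simp only [U_ofReal, DeltaXi_ofReal, shift_ofReal]
  push_cast
  rfl

/-! ### §2 The real floor `(4∕π²)^d ≤ 𝓝_L` on the Brillouin zone, all `L ≥ 1` -/

/-- REAL FLOOR (S-64-1 THEOREM S step (i)): `(4∕π²)^d ≤ 𝓝_L(s)` for real `s` with `|s_μ| ≤ π`, every `L ≥ 1` — the `k = 0` term is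
`|u_L(s)|² ≥ (4∕π²)^d` (`B4Strip.Ur_zero_ge`) and every alias term is a product and quotient of non-negative reals (the lines `h2`,
`h3` of the tree's `B4Strip.Er_ge`, i.e. `Er_ge` divided by `a` as `a → ∞`). [folklore] -/
theorem Nsymr_ge (L : ℕ) [NeZero L] (hL : 1 ≤ L) (s : Fin d → ℝ) (hs : ∀ μ, |s μ| ≤ Real.pi) :
    (4 / Real.pi ^ 2) ^ d ≤ Nsymr L s := by
  unfold Nsymr
  have h1 := DeltaXir_nonneg L 0 le_rfl s
  have h2 := Ur_zero_ge L hL s hs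
  have h3 : 0 ≤ ∑ k ∈ (Finset.univ.erase (fun _ => (0 : Fin L))),
        Ur L k s * (DeltaXir L 0 s / DeltaXir L 0 (shiftr L k s)) := by
    apply Finset.sum_nonneg; intro k _
    exact mul_nonneg (Ur_nonneg _ _ _) (div_nonneg h1 (DeltaXir_nonneg L 0 le_rfl _))
  linarith

/-- real floor in modulus form: `(4∕π²)^d ≤ ‖𝓝_L(s)‖` on the Brillouin zone. [folklore] -/
theorem Nsym_real_ge (L : ℕ) [NeZero L] (hL : 1 ≤ L) (s : Fin d → ℝ) (hs : ∀ μ, |s μ| ≤ Real.pi) :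
    (4 / Real.pi ^ 2) ^ d ≤ ‖Nsym L (ofRealVec s)‖ := by
  rw [Nsym_ofReal, Complex.norm_real]
  exact (Nsymr_ge L hL s hs).trans (le_abs_self _)

/-- `𝓝_L(s) > 0` on the Brillouin zone. [folklore] -/
theorem Nsymr_pos (L : ℕ) [NeZero L] (hL : 1 ≤ L) (s : Fin d → ℝ) (hs : ∀ μ, |s μ| ≤ Real.pi) : 0 < Nsymr L s :=
  lt_of_lt_of_le (by positivity) (Nsymr_ge L hL s hs)

/-! ### §3 The fat-region bound `‖𝓝_L‖ ≤ M_N(d)`, uniform in `L` -/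

/-- the fat-region bound `M_N(d) = 4^d + 8d·132^d` of `𝓝_L` (the `a`-slope of `B4StripCauchy.boundM` at `m²₊ = 0`). [folklore] -/
def MN (d : ℕ) : ℝ := 4 ^ d + 8 * d * 132 ^ d

/-- `M_N(d) > 0`. [folklore] -/
theorem MN_pos (d : ℕ) : 0 < MN d := by unfold MN; positivity

/-- FAT-REGION BOUND (S-64-1 THEOREM S step (iii)): `‖𝓝_L(q)‖ ≤ 4^d + 8d·132^d` on `Fat d r` (`r ≤ 1∕4`, `d r² ≤ 1∕16`), UNIFORMLY IN
`L ≥ 1`: `‖U_L(0;q)‖ ≤ 4^d` (`norm_U_zero_le`), `Σ_k ‖U_L(k;q)‖ ≤ 132^d` (`sum_norm_U_le`), `‖Δ^ξ_L(q)‖ ≤ 16d` (`norm_DeltaXi_le`),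
`‖Δ^ξ_L(q + 2πk)‖ ≥ 2` for `k ≠ 0` (`norm_DeltaXi_shift_ge`). [folklore] -/
theorem norm_Nsym_le (L : ℕ) [NeZero L] {r : ℝ} (hr : r ≤ 1 / 4) (hdr : (d : ℝ) * r ^ 2 ≤ 1 / 16)
    {q : Fin d → ℂ} (hq : q ∈ Fat d r) : ‖Nsym L q‖ ≤ MN d := by
  have hL : 1 ≤ L := Nat.one_le_iff_ne_zero.mpr (NeZero.ne L)
  have hD : ‖DeltaXi L 0 q‖ ≤ 16 * d := by
    have := norm_DeltaXi_le L hL 0 le_rfl hr hq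
    linarith
  have hU0 := norm_U_zero_le L hr hq
  have hterm : ∀ k ∈ (Finset.univ.erase (fun _ => (0 : Fin L))),
      ‖U L k q * (DeltaXi L 0 q / DeltaXi L 0 (shift L k q))‖ ≤ ‖U L k q‖ * (8 * d) := by
    intro k hk
    have hk0 : k ≠ fun _ => 0 := Finset.ne_of_mem_erase hk
    have h2 : 2 ≤ ‖DeltaXi L 0 (shift L k q)‖ := norm_DeltaXi_shift_ge L 0 le_rfl hr hdr hq k hk0
    rw [norm_mul, norm_div]
    apply mul_le_mul_of_nonneg_left _ (norm_nonneg _)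
    rw [div_le_iff₀ (by linarith)]
    nlinarith [norm_nonneg (DeltaXi L 0 q), Nat.cast_nonneg (α := ℝ) d]
  have hsum : ‖∑ k ∈ Finset.univ.erase (fun _ => (0 : Fin L)),
      U L k q * (DeltaXi L 0 q / DeltaXi L 0 (shift L k q))‖ ≤ 132 ^ d * (8 * d) := by
    calc ‖∑ k ∈ Finset.univ.erase (fun _ => (0 : Fin L)),
          U L k q * (DeltaXi L 0 q / DeltaXi L 0 (shift L k q))‖
        ≤ ∑ k ∈ Finset.univ.erase (fun _ => (0 : Fin L)),
          ‖U L k q * (DeltaXi L 0 q / DeltaXi L 0 (shift L k q))‖ := norm_sum_le _ _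
      _ ≤ ∑ k ∈ Finset.univ.erase (fun _ => (0 : Fin L)), ‖U L k q‖ * (8 * d) :=
          Finset.sum_le_sum hterm
      _ ≤ ∑ k : Fin d → Fin L, ‖U L k q‖ * (8 * d) :=
          Finset.sum_le_sum_of_subset_of_nonneg (Finset.erase_subset _ _)
            (fun k _ _ => by positivity)
      _ = (∑ k : Fin d → Fin L, ‖U L k q‖) * (8 * d) := by rw [Finset.sum_mul]
      _ ≤ 132 ^ d * (8 * d) := by gcongr; exact sum_norm_U_le L hr hq
  unfold Nsym MN
  calc ‖U L (fun _ => (0 : Fin L)) q +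
        ∑ k ∈ Finset.univ.erase (fun _ => (0 : Fin L)), U L k q * (DeltaXi L 0 q / DeltaXi L 0 (shift L k q))‖
      ≤ ‖U L (fun _ => (0 : Fin L)) q‖ +
        ‖∑ k ∈ Finset.univ.erase (fun _ => (0 : Fin L)), U L k q * (DeltaXi L 0 q / DeltaXi L 0 (shift L k q))‖ :=
        norm_add_le _ _
    _ ≤ 4 ^ d + 132 ^ d * (8 * d) := add_le_add hU0 hsum
    _ = 4 ^ d + 8 * d * 132 ^ d := by ring

/-! ### §4 Joint holomorphy on the fat region and the imaginary-direction Lipschitz bound -/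

/-- `𝓝_L` is holomorphic (jointly in `p ∈ ℂ^d`) at every point of the fat region (`r ≤ 1∕4`, `d r² ≤ 1∕16`), uniformly in `L ≥ 1`
(`B5Strip145Analytic.differentiableAt_E` at `(a, m²) = (1, 0)` minus `differentiableAt_DeltaXi`). [folklore] -/
theorem differentiableAt_Nsym (L : ℕ) [NeZero L] {r : ℝ} (hr : r ≤ 1 / 4) (hdr : (d : ℝ) * r ^ 2 ≤ 1 / 16)
    {q : Fin d → ℂ} (hq : q ∈ Fat d r) : DifferentiableAt ℂ (Nsym L) q := by
  rw [Nsym_eq_fun]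
  exact (differentiableAt_E L 1 0 le_rfl hr hdr hq).sub (differentiableAt_DeltaXi L 0 q)

/-- slice form: `w ↦ 𝓝_L(q[μ := w])` is holomorphic at `q_μ` for `q` in the fat region. [folklore] -/
theorem differentiableAt_Nsym_slice (L : ℕ) [NeZero L] {r : ℝ} (hr : r ≤ 1 / 4) (hdr : (d : ℝ) * r ^ 2 ≤ 1 / 16)
    {q : Fin d → ℂ} (hq : q ∈ Fat d r) (μ : Fin d) :
    DifferentiableAt ℂ (fun w => Nsym L (Function.update q μ w)) (q μ) := by
  have h := differentiableAt_Nsym L hr hdr hq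
  rw [← Function.update_eq_self μ q] at h
  exact h.comp (q μ) (differentiableAt_update q μ (q μ))

/-- `𝓝_L` is continuous at every point of the fat region. [folklore] -/
theorem continuousAt_Nsym (L : ℕ) [NeZero L] {r : ℝ} (hr : r ≤ 1 / 4) (hdr : (d : ℝ) * r ^ 2 ≤ 1 / 16)
    {q : Fin d → ℂ} (hq : q ∈ Fat d r) : ContinuousAt (Nsym L) q :=
  (differentiableAt_Nsym L hr hdr hq).continuousAt

/-- the imaginary-direction Lipschitz constant `Λ_N(d) = M_N(d) ∕ r(d)`. [folklore] -/
def LamN (d : ℕ) : ℝ := MN d / rOf d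

/-- `Λ_N(d) ≥ 0`. [folklore] -/
theorem LamN_nonneg (d : ℕ) : 0 ≤ LamN d := div_nonneg (MN_pos d).le (rOf_pos d).le

/-- IMAGINARY-DIRECTION LIPSCHITZ BOUND (S-64-1 THEOREM S step (iv)): for `0 ≤ κ ≤ r(d)` and `p` in the strip of half-width `κ`,
`‖𝓝_L(p) − 𝓝_L(Re p)‖ ≤ Λ_N(d) · Σ_μ |Im p_μ|` (`B4StripCauchy.imLipschitz_of_fat` fed with §3 and §4), every `L ≥ 1`. [folklore] -/
theorem Nsym_imLipschitz (L : ℕ) [NeZero L] {κ : ℝ} (hκ0 : 0 ≤ κ) (hκr : κ ≤ rOf d) :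
    ∀ p ∈ Strip d κ, ‖Nsym L p - Nsym L (ofRealVec (reVec p))‖ ≤ LamN d * ∑ μ, |(p μ).im| := by
  have hdiff : ∀ q ∈ Fat d (rOf d), ∀ μ, DifferentiableAt ℂ (fun w => Nsym L (Function.update q μ w)) (q μ) :=
    fun q hq μ => differentiableAt_Nsym_slice L (rOf_le d) (d_mul_rOf_sq_le d) hq μ
  have hbound : ∀ q ∈ Fat d (rOf d), ‖Nsym L q‖ ≤ MN d :=
    fun q hq => norm_Nsym_le L (rOf_le d) (d_mul_rOf_sq_le d) hq
  unfold LamN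
  exact imLipschitz_of_fat (Nsym L) (rOf_pos d) hκ0 hκr hdiff hbound

/-! ### §5 THEOREM S: the zero-free strip of `𝓝_L`, half-width depending on `d` alone -/

/-- the strip floor `c_N(d) = (4∕π²)^d ∕ 2`. [folklore] -/
def cN (d : ℕ) : ℝ := (4 / Real.pi ^ 2) ^ d / 2

/-- `c_N(d) > 0`. [folklore] -/
theorem cN_pos (d : ℕ) : 0 < cN d := by unfold cN; positivity

/-- `c_N(d) ≤ 1∕2`. [folklore] -/
theorem cN_le_half (d : ℕ) : cN d ≤ 1 / 2 := by
  unfold cN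
  have h1 : (4 / Real.pi ^ 2) ^ d ≤ 1 := pow_le_one₀ (by positivity) four_div_pi_sq_le_one
  linarith

/-- THE STRIP HALF-WIDTH `κ_N(d) = min (r(d), c_N(d) ∕ (Λ_N(d)·d + 1))` — explicit in `d` alone (the shape of
`B4StripCauchy.uniformStrip_explicit`'s `κ₀`). [folklore] -/
def kappaN (d : ℕ) : ℝ := min (rOf d) (cN d / (LamN d * d + 1))

/-- `κ_N(d) > 0`. [folklore] -/
theorem kappaN_pos (d : ℕ) : 0 < kappaN d := by
  unfold kappaN
  have := LamN_nonneg d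
  exact lt_min (rOf_pos d) (div_pos (cN_pos d) (by positivity))

/-- `κ_N(d) ≤ r(d) = 1∕(4(d+1))`. [folklore] -/
theorem kappaN_le_rOf (d : ℕ) : kappaN d ≤ rOf d := min_le_left _ _

/-- `κ_N(d) ≤ 1` and `d·κ_N(d)² ≤ 1∕16` (the side conditions of the strip lemmas). [folklore] -/
theorem kappaN_small (d : ℕ) : kappaN d ≤ 1 ∧ (d : ℝ) * kappaN d ^ 2 ≤ 1 / 16 :=
  kappa_small (kappaN_pos d).le (kappaN_le_rOf d)

/-- the smallness `Λ_N(d)·(d·κ_N(d)) ≤ c_N(d)` built into `κ_N`. [folklore] -/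
theorem LamN_mul_le (d : ℕ) : LamN d * (d * kappaN d) ≤ cN d := by
  have hΛ := LamN_nonneg d
  have hden : 0 < LamN d * d + 1 := by positivity
  have h1 : kappaN d ≤ cN d / (LamN d * d + 1) := min_le_right _ _
  have h2 : LamN d * d * kappaN d ≤ LamN d * d * (cN d / (LamN d * d + 1)) :=
    mul_le_mul_of_nonneg_left h1 (by positivity)
  have h3 : LamN d * d * (cN d / (LamN d * d + 1)) ≤ cN d := by
    rw [mul_div_assoc', div_le_iff₀ hden]
    nlinarith [cN_pos d]
  calc LamN d * (d * kappaN d) = LamN d * d * kappaN d := by ring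
    _ ≤ cN d := h2.trans h3

/-- **THEOREM S** (lens 2's S-64-1 §2, desk PRICING-NE7 v32 §233 (f) «CORRECT AS A PAPER PROOF OVER THE TREE'S OWN §3 ARCHITECTURE»;
now kernel-checked).  For every dimension `d`, EVERY blocking factor `L ≥ 1` and every complex momentum `p` of the strip
`|Re p_μ| ≤ π`, `|Im p_μ| ≤ κ_N(d)`:  `‖𝓝_L(p)‖ ≥ c_N(d) = (4∕π²)^d ∕ 2`.  Route: `B4Strip.strip_lower_bound` with the real floor
`2c_N` (§2), the imaginary-direction Lipschitz bound `Λ_N` (§4) and the smallness `Λ_N·d·κ_N ≤ c_N` (`LamN_mul_le`); no Combes–Thomas,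
no torus, no infinite lattice (I3-free, torus-free), `κ_N` depending on `d` ALONE. [folklore] -/
theorem Nsym_strip_lower (L : ℕ) [NeZero L] : ∀ p ∈ Strip d (kappaN d), cN d ≤ ‖Nsym L p‖ := by
  have hL : 1 ≤ L := Nat.one_le_iff_ne_zero.mpr (NeZero.ne L)
  apply strip_lower_bound (Nsym L) (cN d) (LamN d) (kappaN d) _ _ (LamN_nonneg d) (LamN_mul_le d)
  · intro s hs
    have := Nsym_real_ge L hL s hs
    unfold cN; linarith
  · exact Nsym_imLipschitz L (kappaN_pos d).le (kappaN_le_rOf d)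

/-- THEOREM S on every narrower strip `0 ≤ κ ≤ κ_N(d)`. [folklore] -/
theorem Nsym_strip_lower_of_le (L : ℕ) [NeZero L] {κ : ℝ} (hκ : κ ≤ kappaN d) :
    ∀ p ∈ Strip d κ, cN d ≤ ‖Nsym L p‖ :=
  fun p hp => Nsym_strip_lower L p (strip_mono hκ hp)

/-- `𝓝_L` HAS NO ZERO on the strip of half-width `κ_N(d)`, for every `L ≥ 1`. [folklore] -/
theorem Nsym_ne_zero (L : ℕ) [NeZero L] {p : Fin d → ℂ} (hp : p ∈ Strip d (kappaN d)) : Nsym L p ≠ 0 := fun h => by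
  have := Nsym_strip_lower L p hp
  rw [h, norm_zero] at this
  exact absurd this (not_le.mpr (cN_pos d))

/-- the strip of half-width `κ_N(d)` lies in the fat region `Fat d r(d)` (so §3–§4 apply on it). [folklore] -/
theorem strip_kappaN_subset_fat : Strip d (kappaN d) ⊆ Fat d (rOf d) :=
  strip_subset_fat (rOf_pos d).le (kappaN_le_rOf d)

/-! ### §6 The block-mean multiplier `k_L = Δ^ξ_L ∕ 𝓝_L` (object; its clauses are file 48's) -/

/-- THE BLOCK-MEAN (hard Schur-complement) MULTIPLIER one blocking level down, as a function on `ℂ^d`: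
`k_L(p) = Δ^ξ_L(p) ∕ 𝓝_L(p)` (`= 1 ∕ Σ_k |u(p+2πk)|² ∕ Δ^ξ_L(p+2πk)` where `Δ^ξ_L(p) ≠ 0`; lens 2's S-64-1 §1, B4 (2.47)–(2.48) one
level down).  On the strip of THEOREM S the denominator has no zero, so this is the holomorphic function the strip engine shifts;
off the fat region the tree's filled factor `B4Strip.uFactor` carries junk values and so does this quotient (no consumer reads it
there). [folklore] -/
def kL (L : ℕ) [NeZero L] (p : Fin d → ℂ) : ℂ := DeltaXi L 0 p / Nsym L p

/-- real form of `k_L`. [folklore] -/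
def kLr (L : ℕ) [NeZero L] (s : Fin d → ℝ) : ℝ := DeltaXir L 0 s / Nsymr L s

/-- on real momenta `k_L` is the real number `kLr` (REALITY, clause (a′)). [folklore] -/
theorem kL_ofReal (L : ℕ) [NeZero L] (s : Fin d → ℝ) : kL L (ofRealVec s) = ((kLr L s : ℝ) : ℂ) := by
  unfold kL kLr
  rw [Nsym_ofReal, DeltaXi_ofReal]
  push_cast
  rfl

/-- `k_L ≥ 0` on the Brillouin zone (SIGN, clause (d′)). [folklore] -/
theorem kLr_nonneg (L : ℕ) [NeZero L] (hL : 1 ≤ L) (s : Fin d → ℝ) (hs : ∀ μ, |s μ| ≤ Real.pi) : 0 ≤ kLr L s :=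
  div_nonneg (DeltaXir_nonneg L 0 le_rfl s) (Nsymr_pos L hL s hs).le

/-- `k_L(0) = 0` (the multiplier vanishes at zero momentum, like `Δ^ξ(0) = 0`). [folklore] -/
theorem kL_zero (L : ℕ) [NeZero L] : kL L (fun _ : Fin d => (0 : ℂ)) = 0 := by
  unfold kL DeltaXi Sxi
  simp

end Summit.QuantumFields.BalabanUV.T4Continuum.NE7K1LinBlochDenominator

end
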